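import Summits.BirchSwinnertonDyer.Rank1Residual.WAll.AltClosersCMTwoRamifiedGenusClass
import Literature.NumberTheory.EllipticCurves.Tian2014.CMPointSystemGenusBridge
import HarnessLib

/-!
# Route `PrintCf2`, crux stmt-BirchSwinnertonDyer-20509 `RamifiedOffTYZOfFacts` — its registered stub
# `stub_offTYZ_atlasFJLeaf` PROVED inside the flag-free bundle (cell `bsd-print-cf2`, p1)

HONEST FRAMING (cell `bsd-print-cf2`; route `PrintCf2`; crux 20509 = the residual of the ramified type OFF the
proved TYZ families, OPEN): the planner's birth skeleton of 20509 cuts it three ways — `stub_offTYZ_uPlusLeaf`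
(𝔅_ram → U⁺ leaf; NOT closable from 𝔅_ram: needs the ∃-display `tyz_genusPointData`, aside 20471),
`stub_offTYZ_atlasFJLeaf` (𝔅_ram → FJ-atlas leaf) and `stub_offTYZ_residual` (𝔅_ram → four-way residual, OPEN, no
print). This file PROVES the middle stub WITHIN 𝔅_ram: Monsky's odd-case count and Rédei–Reichardt, which the planner
listed as outside the bundle, are THEOREMS of the tree (`HeathBrown1994.monsky_card_selmerGroup_two_odd_holds`,
`redeiReichardt_fourTwoCard_classGroup_holds`), so the closer `wAllCornerFTwoRamifiedTYZAtlasFJ_of_facts` (p538378)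
needs only TYZ17 Thm 1.2′ and GZK. No route file imported (bsd-wall T9: the stub is stated over Literature facts and a
W-ALL leaf, verbatim as registered). Nothing asserted. Beyond print: YES (flag-free assembly).
[cite: TianYuanZhang2017, Thm. 1.2 (as printed)] [cite: FaulknerJames2007, Thm. 1.2 (2)]
[cite: HeathBrown1994SelmerCongruentII, Appendix (Monsky)] [cite: Miller2011LMS, Def. 1.1]
-/

noncomputable section

open scoped Classical

open Summit.BirchSwinnertonDyer Summit.BirchSwinnertonDyer.Rank1Residual.WAll

set_option autoImplicit false

namespace Summit.BirchSwinnertonDyer.PrintCf2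

/-- **REGISTERED STUB `stub_offTYZ_atlasFJLeaf` of crux 20509, PROVED** (signature verbatim): 𝔅_ram ⟹ the FJ-atlas
leaf `WAllCornerFTwoRamifiedTYZAtlasFJ` (facts used: conjunct 5 = TYZ Thm 1.2′ and conjunct 1 = GZK).
[cite: TianYuanZhang2017, Thm. 1.2 (as printed)] [cite: FaulknerJames2007, Thm. 1.2 (2)] -/
theorem stub_offTYZ_atlasFJLeaf : (Literature.NumberTheory.EllipticCurves.rank_eq_analyticRank_of_analyticRank_le_one ∧ WeierstrassCurve.hasEntireLFunction_rat ∧ WeierstrassCurve.bsdRHS_eq_of_isIsogenous ∧ Literature.NumberTheory.EllipticCurves.bsdTriple_of_hasCM_of_L_one_ne_zero ∧ Literature.NumberTheory.EllipticCurves.TianYuanZhang2017.thm12_parity_of_scriptL' ∧ Literature.NumberTheory.EllipticCurves.Tian2014.thm13_rank_one_and_sha_odd ∧ Literature.NumberTheory.QuadraticFields.RedeiReichardt.redeiReichardt_fourTwoCard_classGroup ∧ Literature.NumberTheory.EllipticCurves.LiLiuTian2024.thm12_bsd_congruentNumberCurve ∧ Literature.NumberTheory.EllipticCurves.Monsky1990.cor515_rank_eq_one_and_card_selmerGroup_two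 ∧ Literature.NumberTheory.EllipticCurves.HeathBrown1994.monsky_card_selmerGroup_two_even ∧ Literature.NumberTheory.EllipticCurves.Tian2014.tian2014_system_sMinus_genus) → Summit.BirchSwinnertonDyer.WAllCornerFTwoRamifiedTYZAtlasFJ :=
  fun hB ↦ Rank1Residual.WAll.PrintCf2.wAllCornerFTwoRamifiedTYZAtlasFJ_of_facts hB.2.2.2.2.1 hB.1

end Summit.BirchSwinnertonDyer.PrintCf2

end
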